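import Summits.CriticalPhenomena.PercolationContinuityZ3.Theorems.PercNearOneGluingNoHeavyLowerTailNineTypeAnchor

/-!
# Nine-type oriented-antipodal programme for `Q44b`: parity toolkit

Support file for crux `stmt-CriticalPhenomena-4575` (master-family programme, quadratic four-point row `Q44b`),
seat `prim-bnk-1` gen 17; memo `run/shared/lean/prim/prim-l12/FROM-prim-bnk-1-gen17-NINE-TYPE-ANCHOR.md` §7, §9.

Small GF(2) counting tools used by the base case of the free types (file `…NineTypeBase.lean`) and meant
for the sequel of the rank programme (gen 16 §8–§10, gen 17): the cardinality of a filter as a sum of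
indicators in `ZMod 2` (`card_filter_cast`); **symmetric double counting mod 2** — for a symmetric relation
`R` on a finite family `B`, `Σ_{b'} #{b : R b b'} ≡ #{b : R b b}` (`sum_card_filter_symm`, off-diagonal
pairs cancel under the swap, `Finset.sum_involution`); the **toggling lemma** — in an up-set `𝔊` the
members above a member `u` with a missing element `x` come in pairs `g ↔ g ∆ {x}`, so their number is even
(`card_supersets_even`; this is why `|𝔊 ∩ ↑u|` is even for every good `u ≠ univ`); and the translation of
"the family `insert ρ A` has no odd target in `𝔊`" into the parity relation
`#{a ∈ A : a ⊆ g} ≡ [ρ ⊆ g]` (`parity_of_no_odd_target`).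

Pure finite combinatorics; no named facts, no sorries, standard axioms.
-/

namespace Summit.CriticalPhenomena.PercolationContinuityZ3.Theorems

namespace NineType

open Finset

variable {α : Type*} [DecidableEq α]

omit [DecidableEq α] in
/-- Cardinality of a filter as a sum of indicators in `ZMod 2`. -/
theorem card_filter_cast (s : Finset (Finset α)) (p : Finset α → Prop) [DecidablePred p] :
    ((#(s.filter p) : ℕ) : ZMod 2) = ∑ x ∈ s, (if p x then (1 : ZMod 2) else 0) := by
  rw [Finset.card_filter]
  push_cast
  rfl

/-- **Symmetric double counting mod 2.**  For a symmetric relation `R` on a finite family `B`,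
`Σ_{b' ∈ B} #{b ∈ B : R b b'} ≡ #{b ∈ B : R b b} (mod 2)` (off-diagonal pairs cancel under the swap). -/
theorem sum_card_filter_symm (B : Finset (Finset α)) (R : Finset α → Finset α → Prop)
    [DecidableRel R] (hsymm : ∀ b ∈ B, ∀ b' ∈ B, R b b' → R b' b) :
    (∑ b' ∈ B, ((#(B.filter (fun b => R b b')) : ℕ) : ZMod 2))
      = ((#(B.filter (fun b => R b b)) : ℕ) : ZMod 2) := by
  -- rewrite everything as sums of indicators over `B ×ˢ B`
  have hL : (∑ b' ∈ B, ((#(B.filter (fun b => R b b')) : ℕ) : ZMod 2))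
      = ∑ p ∈ B ×ˢ B, (if R p.1 p.2 then (1 : ZMod 2) else 0) := by
    rw [Finset.sum_product_right]
    refine Finset.sum_congr rfl ?_
    intro b' _
    exact card_filter_cast B (fun b => R b b')
  -- the off-diagonal part vanishes
  set f : Finset α × Finset α → ZMod 2 :=
    fun p => if p.1 = p.2 then 0 else (if R p.1 p.2 then 1 else 0) with hf
  have hoff : ∑ p ∈ B ×ˢ B, f p = 0 := by
    refine Finset.sum_involution (fun p _ => (p.2, p.1)) ?_ ?_ ?_ ?_
    · intro p hp
      rcases Finset.mem_product.1 hp with ⟨h1, h2⟩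
      by_cases heq : p.1 = p.2
      · simp [hf, heq]
      · have heq' : ¬ p.2 = p.1 := fun h => heq h.symm
        by_cases hR : R p.1 p.2
        · have hR' : R p.2 p.1 := hsymm p.1 h1 p.2 h2 hR
          simp [hf, heq, heq', hR, hR', CharTwo.add_self_eq_zero]
        · have hR' : ¬ R p.2 p.1 := fun h => hR (hsymm p.2 h2 p.1 h1 h)
          simp [hf, heq, heq', hR, hR']
    · intro p _ hne
      have heq : ¬ p.1 = p.2 := by
        intro h
        apply hne
        simp [hf, h]
      intro h
      apply heq
      have := congrArg Prod.fst h
      exact this.symm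
    · intro p hp
      rcases Finset.mem_product.1 hp with ⟨h1, h2⟩
      exact Finset.mem_product.2 ⟨h2, h1⟩
    · intro p _
      rfl
  -- the diagonal part is the right-hand side
  have hdiag : ∑ p ∈ B ×ˢ B, (if p.1 = p.2 then (if R p.1 p.2 then (1 : ZMod 2) else 0) else 0)
      = ((#(B.filter (fun b => R b b)) : ℕ) : ZMod 2) := by
    rw [card_filter_cast, Finset.sum_product]
    refine Finset.sum_congr rfl ?_
    intro b hb
    rw [Finset.sum_ite_eq B b (fun b' => if R b b' then (1 : ZMod 2) else 0)]
    simp [hb]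
  -- split the full sum
  have hsplit : ∑ p ∈ B ×ˢ B, (if R p.1 p.2 then (1 : ZMod 2) else 0)
      = ∑ p ∈ B ×ˢ B, f p
        + ∑ p ∈ B ×ˢ B, (if p.1 = p.2 then (if R p.1 p.2 then (1 : ZMod 2) else 0) else 0) := by
    rw [← Finset.sum_add_distrib]
    refine Finset.sum_congr rfl ?_
    intro p _
    by_cases heq : p.1 = p.2
    · simp [hf, heq]
    · simp [hf, heq]
  rw [hL, hsplit, hoff, hdiag, zero_add]

/-- Toggling an element outside a good set `u` pairs up the goods above `u`: if the up-set `𝔊` contains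
`u` and `x ∉ u`, then `#{g ∈ 𝔊 : u ⊆ g}` is even. -/
theorem card_supersets_even (𝔊 : Finset (Finset α))
    (hG : ∀ g ∈ 𝔊, ∀ g' : Finset α, g ⊆ g' → g' ∈ 𝔊)
    (u : Finset α) (hu : u ∈ 𝔊) (x : α) (hx : x ∉ u) :
    ((#(𝔊.filter (fun g => u ⊆ g)) : ℕ) : ZMod 2) = 0 := by
  rw [card_filter_cast]
  rw [← Finset.sum_filter]
  refine Finset.sum_involution (fun g _ => symmDiff g {x}) ?_ ?_ ?_ ?_
  · intro g _
    exact CharTwo.add_self_eq_zero (1 : ZMod 2)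
  · intro g _ _ h
    have : ({x} : Finset α) = ⊥ := (symmDiff_eq_left).1 h
    exact Finset.singleton_ne_empty x this
  · intro g hg
    rcases Finset.mem_filter.1 hg with ⟨_, hug⟩
    have hsub : u ⊆ symmDiff g {x} := by
      intro y hy
      rw [Finset.mem_symmDiff]
      left
      refine ⟨hug hy, ?_⟩
      intro hyx
      rw [Finset.mem_singleton] at hyx
      exact hx (hyx ▸ hy)
    exact Finset.mem_filter.2 ⟨hG u hu _ hsub, hsub⟩
  · intro g _
    exact symmDiff_symmDiff_cancel_right {x} g

/-- From "no odd target for a family `insert ρ A`" to the parity relation used in `base_false`. -/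
theorem parity_of_no_odd_target (A : Finset (Finset α)) (ρ : Finset α) (hρ : ρ ∉ A)
    (𝔊 : Finset (Finset α))
    (hno : ∀ g ∈ 𝔊, ¬ Odd #((insert ρ A).filter (fun S => S ⊆ g))) :
    ∀ g ∈ 𝔊, ((#(A.filter (fun a => a ⊆ g)) : ℕ) : ZMod 2) = if ρ ⊆ g then 1 else 0 := by
  intro g hg
  have heven : Even #((insert ρ A).filter (fun S => S ⊆ g)) := Nat.not_odd_iff_even.1 (hno g hg)
  rw [Finset.filter_insert] at heven
  by_cases hρg : ρ ⊆ g
  · rw [if_pos hρg] at heven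
    rw [if_pos hρg]
    have hnot : ρ ∉ A.filter (fun a => a ⊆ g) := fun h => hρ (Finset.mem_filter.1 h).1
    rw [Finset.card_insert_of_notMem hnot] at heven
    have hodd : Odd #(A.filter (fun a => a ⊆ g)) := by
      rcases heven with ⟨k, hk⟩
      exact ⟨k - 1, by omega⟩
    have h1 : ((#(A.filter (fun a => a ⊆ g)) : ℕ) : ZMod 2) ≠ 0 := by
      intro h0
      exact (Nat.not_even_iff_odd.2 hodd) ((ZMod.natCast_eq_zero_iff_even).1 h0)
    generalize ((#(A.filter (fun a => a ⊆ g)) : ℕ) : ZMod 2) = z at h1 ⊢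
    fin_cases z
    · exact absurd rfl h1
    · rfl
  · rw [if_neg hρg] at heven
    rw [if_neg hρg]
    exact (ZMod.natCast_eq_zero_iff_even).2 heven


end NineType

end Summit.CriticalPhenomena.PercolationContinuityZ3.Theorems
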